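import Summits.AtomisticToContinuum.HydrodynamicLimit.Theorems.KineticFluxLdDecay.Negative.HTheoremMixtureOneBody
import Summits.AtomisticToContinuum.HydrodynamicLimit.Theorems.AntiMazurCoboundariesKineticFluxLdDecayGainDominationLocal
import Summits.AtomisticToContinuum.HydrodynamicLimit.Theorems.AntiMazurCoboundariesKineticFluxLdDecayPositionTailBudget
import Literature.MathematicalPhysics.KineticTheory.Hilbert6Wave0HTheoremProofs
import HarnessLib

/-!
# The macrostate-mixture witness — its cut one-body density has a constant positive Hellinger production
# (crux `KineticFluxLdDecay`, stmt-AtomisticToContinuum-10967; line `h-theorem-dissipation-budget`)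

Continuation of `…/Negative/HTheoremMixture{Statics,OneBody}.lean`. With `f_t = π̄_N ⊗ γ·r`
(`MixtureWitness.oneBodyLaw_mixtureLaw`, `r = velMixDensity`) the one-body density of the witness is
`ρ_t(x, w) = n(x) r(w)` a.e. (`n = dπ̄_N/dvol`), its position density is `n`, and the CUT density of the bet
`NoPerpetualDissipationBdd` is `1_{n ≤ K}(x) n(x) r(w)`. By 2-homogeneity of the Hellinger production in each fibre,

  `𝒟(cutDensity K) = (∫_{n ≤ K} n² dvol) · D(r)`,  `D(r) = ∫ B M M_* Ξ(r)² dv dv_* dω`,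

and `∫_{n ≤ K} n² ≥ (∫_{n ≤ K} n)² = π̄_N{n ≤ K}² ≥ 1/4` by Cauchy–Schwarz on the probability space `(𝕋³, vol)` and
the landed position-tail budget `stub_positionTailBudget` (mass of `{n > K}` is `≤ 2(s + 2)/log K ≤ 1/2` for
`log K ≥ 4(S₀ + 2)`). Finally `D(r) > 0`: the integrand is continuous, and strictly positive at the explicit
non-degenerate collision `v = 0`, `v_* = (-1,-1,0)`, `ω = (1,0,0)` (a Gaussian scale mixture is not a Maxwellian:
`r(v')r(v'_*) − r(v)r(v_*) ∝ -(e^{1/4} − 1)² ≠ 0`), so it is positive on a non-empty open set, which has positive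
`dv dv_* dω`-measure (`isOpenPosMeasure_volume_prod_sphereMeasure`).
-/

noncomputable section

open MeasureTheory ProbabilityTheory Set Filter InformationTheory
open scoped ENNReal NNReal

namespace Summit.AtomisticToContinuum.HydrodynamicLimit.Theorems.HTheorem

open Literature.MathematicalPhysics.KineticTheory (T3 V3 hsDiameter localGibbsLaw localGibbsMeasure gaussMeasure
  posGibbsMeasure collide sphereMeasure hardSphereKernel isOpenPosMeasure_volume_prod_sphereMeasure)
open Literature.Analysis.FluidPDE (HardSphereFlow Config globalMaxwellian globalMaxwellian_pos continuous_collide_uncurry)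
open Literature.Analysis.UnboundedOperators (collisionDensity collisionDensity_nonneg continuous_collisionDensity)
open Summit.AtomisticToContinuum.HydrodynamicLimit.Theorems.KineticFluxLdDecayTilt (llr1 llrConfig)

namespace MixtureWitness

/-! ## The Hellinger production of the velocity factor is positive -/

/-- The Hellinger production `D(r) = ∫ B M M_* Ξ(r)² dv dv_* dω ∈ (0, ∞]` of the velocity factor `r` of the
witness (the one-body production of the witness per unit `∫ n²`). -/
def velMixProduction : ℝ≥0∞ :=
  ∫⁻ q, ENNReal.ofReal (collisionDensity q * hellingerDefect velMixDensity q ^ 2) ∂collMeasure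

/-- The Hellinger defect of a continuous velocity density is continuous on collision space. -/
theorem continuous_hellingerDefect {r : V3 → ℝ} (hr : Continuous r) : Continuous (hellingerDefect r) := by
  unfold hellingerDefect
  have hc : Continuous fun q : CollSpace => collide q.2 q.1 := continuous_collide_uncurry
  fun_prop

/-- Closed form of the velocity factor: `r(w) = ½ + ½ exp(‖w‖²/4 − (3/2) log 2)`. -/
theorem velMixDensity_eq (w : V3) :
    velMixDensity w = 2⁻¹ + 2⁻¹ * Real.exp (‖w‖ ^ 2 / 4 - 3 / 2 * Real.log 2) := by
  rw [velMixDensity, Summit.AtomisticToContinuum.HydrodynamicLimit.Theorems.KineticFluxLdDecayTilt.llr1_eq two_pos]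
  congr 2
  rw [sub_zero]
  ring

/-- The explicit non-degenerate collision: `v = 0`, `v_* = (-1,-1,0)`, `ω = (1,0,0)`; then `(v − v_*)·ω = 1`,
`v' = (-1,0,0)`, `v'_* = (0,-1,0)`. -/
def omega0 : Metric.sphere (0 : V3) 1 :=
  ⟨!₂[1, 0, 0], by simp [EuclideanSpace.norm_eq, Fin.sum_univ_three]⟩

/-- The explicit collision point `q₀ = ((v, v_*), ω)`. -/
def q0 : CollSpace := ((0, !₂[-1, -1, 0]), omega0)

/-- `(v − v_*)·ω = 1` at `q₀`. -/
theorem inner_q0 : inner ℝ ((q0.1.1 : V3) - q0.1.2) (omega0 : V3) = 1 := by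
  simp [q0, omega0, PiLp.inner_apply, Fin.sum_univ_three]

/-- The post-collisional velocities at `q₀`: `v' = (-1,0,0)`, `v'_* = (0,-1,0)`. -/
theorem collide_q0 : collide q0.2 q0.1 = (!₂[-1, 0, 0], !₂[0, -1, 0]) := by
  have h := inner_q0
  simp only [q0] at h ⊢
  rw [collide, h, one_smul]
  refine Prod.ext ?_ ?_
  · ext i; fin_cases i <;> simp [omega0]
  · ext i; fin_cases i <;> simp [omega0]

/-- `‖v‖² = 0` at `q₀`. -/
theorem norm_sq_v0 : ‖(q0.1.1 : V3)‖ ^ 2 = 0 := by simp [q0]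
/-- `‖v_*‖² = 2` at `q₀`. -/
theorem norm_sq_vstar0 : ‖(q0.1.2 : V3)‖ ^ 2 = 2 := by
  simp [q0, EuclideanSpace.norm_eq, Fin.sum_univ_three]
  norm_num
/-- `‖v'‖² = 1` at `q₀`. -/
theorem norm_sq_vprime0 : ‖(!₂[-1, 0, 0] : V3)‖ ^ 2 = 1 := by
  simp [EuclideanSpace.norm_eq, Fin.sum_univ_three]
/-- `‖v'_*‖² = 1` at `q₀`. -/
theorem norm_sq_vprimestar0 : ‖(!₂[0, -1, 0] : V3)‖ ^ 2 = 1 := by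
  simp [EuclideanSpace.norm_eq, Fin.sum_univ_three]

/-- **A Gaussian scale mixture is not a Maxwellian**: the Hellinger defect of `r` at `q₀` is non-zero
(`r(v')r(v'_*) − r(v)r(v_*) = -¼ c (e^{1/4} − 1)² ≠ 0`, `c = 2^{-3/2}`). -/
theorem hellingerDefect_q0_ne_zero : hellingerDefect velMixDensity q0 ≠ 0 := by
  set c : ℝ := Real.exp (-(3 / 2 * Real.log 2)) with hc
  set a : ℝ := Real.exp (1 / 4) with ha
  have hc0 : 0 < c := Real.exp_pos _
  have ha1 : 1 < a := by rw [ha]; exact Real.one_lt_exp_iff.2 (by norm_num)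
  have hR : ∀ w : V3, velMixDensity w = 2⁻¹ * (1 + c * Real.exp (‖w‖ ^ 2 / 4)) := by
    intro w
    rw [velMixDensity_eq, sub_eq_add_neg, Real.exp_add]
    ring
  have hv : velMixDensity q0.1.1 = 2⁻¹ * (1 + c) := by
    rw [hR, norm_sq_v0]; simp
  have hvs : velMixDensity q0.1.2 = 2⁻¹ * (1 + c * a ^ 2) := by
    rw [hR, norm_sq_vstar0, ha, ← Real.exp_nat_mul]; norm_num
  have hv' : velMixDensity (collide q0.2 q0.1).1 = 2⁻¹ * (1 + c * a) := by
    rw [collide_q0, hR, norm_sq_vprime0]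
  have hvs' : velMixDensity (collide q0.2 q0.1).2 = 2⁻¹ * (1 + c * a) := by
    rw [collide_q0, hR, norm_sq_vprimestar0]
  intro h0
  rw [hellingerDefect, sub_eq_zero, hv, hvs, hv', hvs', ← Real.sqrt_mul (by positivity),
    ← Real.sqrt_mul (by positivity)] at h0
  have h1 : 2⁻¹ * (1 + c * a) * (2⁻¹ * (1 + c * a)) = 2⁻¹ * (1 + c) * (2⁻¹ * (1 + c * a ^ 2)) := by
    have := congrArg (fun x => x ^ 2) h0
    simpa only [Real.sq_sqrt (by positivity : (0:ℝ) ≤ 2⁻¹ * (1 + c * a) * (2⁻¹ * (1 + c * a))),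
      Real.sq_sqrt (by positivity : (0:ℝ) ≤ 2⁻¹ * (1 + c) * (2⁻¹ * (1 + c * a ^ 2)))] using this
  have h2 : c * (a - 1) ^ 2 = 0 := by nlinarith
  rcases mul_eq_zero.1 h2 with h3 | h3
  · exact hc0.ne' h3
  · have : a - 1 = 0 := pow_eq_zero_iff (n := 2) (by norm_num) |>.1 h3
    linarith

/-- The collision density is strictly positive at `q₀` (`(v − v_*)·ω = 1 > 0`). -/
theorem collisionDensity_q0_pos : 0 < collisionDensity q0 := by
  have h : inner ℝ (q0.1.1 - q0.1.2) ((q0.2 : Metric.sphere (0 : V3) 1) : V3) = 1 := inner_q0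
  unfold collisionDensity hardSphereKernel
  rw [h]
  exact mul_pos (by norm_num) (mul_pos (globalMaxwellian_pos _) (globalMaxwellian_pos _))

/-- The production integrand is strictly positive at `q₀`. -/
theorem integrand_q0_pos : 0 < collisionDensity q0 * hellingerDefect velMixDensity q0 ^ 2 :=
  mul_pos collisionDensity_q0_pos
    (lt_of_le_of_ne (sq_nonneg _) (Ne.symm (pow_ne_zero 2 hellingerDefect_q0_ne_zero)))

/-- **`D(r) > 0`**: the production integrand is continuous and positive at `q₀`, hence positive on a non-empty
open set, which has positive `dv dv_* dω`-measure. -/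
theorem velMixProduction_ne_zero : velMixProduction ≠ 0 := by
  set F : CollSpace → ℝ := fun q => collisionDensity q * hellingerDefect velMixDensity q ^ 2 with hF
  have hFc : Continuous F :=
    continuous_collisionDensity.mul ((continuous_hellingerDefect continuous_velMixDensity).pow 2)
  have hU : IsOpen {q : CollSpace | 0 < F q} := isOpen_lt continuous_const hFc
  have hq0 : q0 ∈ {q : CollSpace | 0 < F q} := integrand_q0_pos
  haveI : (collMeasure).IsOpenPosMeasure := by
    change (((volume : Measure V3).prod (volume : Measure V3)).prod sphereMeasure).IsOpenPosMeasure
    exact isOpenPosMeasure_volume_prod_sphereMeasure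
  have hpos : 0 < collMeasure {q : CollSpace | 0 < F q} := hU.measure_pos _ ⟨q0, hq0⟩
  have hsub : {q : CollSpace | 0 < F q} ⊆ Function.support fun q => ENNReal.ofReal (F q) := by
    intro q hq
    simp only [Function.mem_support, ne_eq, ENNReal.ofReal_eq_zero, not_le]
    exact hq
  have hmeas : Measurable fun q => ENNReal.ofReal (F q) := hFc.measurable.ennreal_ofReal
  intro h0
  have : 0 < velMixProduction := by
    rw [velMixProduction, lintegral_pos_iff_support hmeas]
    exact hpos.trans_le (measure_mono hsub)
  exact this.ne' h0


/-! ## Production of tensorised densities -/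

/-- **Fibrewise 2-homogeneity**: the production of `(x, w) ↦ c(x) r(w)` (`c ≥ 0` measurable) factorises as
`(∫ c² dvol) · D(r)`. -/
theorem production_tensor {c : T3 → ℝ} (hc0 : ∀ x, 0 ≤ c x) (hcm : Measurable c) (r : V3 → ℝ) :
    production (fun y => c y.1 * r y.2) =
      (∫⁻ x, ENNReal.ofReal (c x ^ 2)) *
        ∫⁻ q, ENNReal.ofReal (collisionDensity q * hellingerDefect r q ^ 2) ∂collMeasure := by
  simp only [production]
  have hx : ∀ x : T3,
      (∫⁻ q, ENNReal.ofReal (collisionDensity q * hellingerDefect (fun w => c x * r w) q ^ 2) ∂collMeasure) =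
        ENNReal.ofReal (c x ^ 2) *
          ∫⁻ q, ENNReal.ofReal (collisionDensity q * hellingerDefect r q ^ 2) ∂collMeasure := by
    intro x
    rw [← lintegral_const_mul' _ _ ENNReal.ofReal_ne_top]
    refine lintegral_congr fun q => ?_
    rw [Localise.hellingerDefect_const_mul (hc0 x) r q, ← ENNReal.ofReal_mul (sq_nonneg _)]
    congr 1
    ring
  simp_rw [hx]
  rw [lintegral_mul_const _ (hcm.pow_const 2).ennreal_ofReal]

/-- Cutting fibres only lowers the production: `𝒟(1_{E × ℝ³} ρ) ≤ 𝒟(ρ)` (a cut fibre is identically `0` and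
produces nothing). -/
theorem production_indicator_prod_le (E : Set T3) (ρ : T3 × V3 → ℝ) :
    production ((E ×ˢ (Set.univ : Set V3)).indicator ρ) ≤ production ρ := by
  simp only [production]
  refine lintegral_mono fun x => ?_
  by_cases hx : x ∈ E
  · refine le_of_eq (lintegral_congr fun q => ?_)
    have : (fun w => (E ×ˢ (Set.univ : Set V3)).indicator ρ (x, w)) = fun w => ρ (x, w) := by
      funext w
      exact Set.indicator_of_mem (show (x, w) ∈ E ×ˢ (Set.univ : Set V3) from ⟨hx, Set.mem_univ _⟩) ρ
    rw [this]
  · have : (fun w => (E ×ˢ (Set.univ : Set V3)).indicator ρ (x, w)) = fun _ => 0 := by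
      funext w
      exact Set.indicator_of_notMem (show (x, w) ∉ E ×ˢ (Set.univ : Set V3) from fun h => hx h.1) ρ
    rw [this]
    simp [hellingerDefect]

/-! ## The cut one-body density of the witness and its production -/

/-- `π̄_N ≪ vol`. (The Haar probability instance on `𝕋³` is supplied inline, as in the landed `stub_gainDomination`;
the tree's named copy lives in an unrelated heavy module.) -/
theorem posLaw_absolutelyContinuous (σ : ℝ) (N : ℕ) : posLaw σ N ≪ (volume : Measure T3) := by
  haveI hT3 : IsProbabilityMeasure (volume : Measure T3) := ⟨by rw [volume_pi, Measure.pi_univ]; simp⟩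
  refine Measure.AbsolutelyContinuous.mk fun s hs hs0 => ?_
  have hpre : ∀ i : Fin (N + 1), posGibbs σ N ((fun x => x i) ⁻¹' s) = 0 := by
    intro i
    have hvol : (volume : Measure (Fin (N + 1) → T3)) ((fun x => x i) ⁻¹' s) = 0 := by
      rw [volume_pi, (measurePreserving_eval (fun _ : Fin (N + 1) => (volume : Measure T3)) i).measure_preimage
        hs.nullMeasurableSet]
      exact hs0
    rw [posGibbs, posGibbsMeasure]
    exact withDensity_absolutelyContinuous _ _ hvol
  have hmap : ∀ i : Fin (N + 1), ((posGibbs σ N).map (fun x => x i)) s = posGibbs σ N ((fun x => x i) ⁻¹' s) :=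
    fun i => Measure.map_apply (measurable_pi_apply i) hs
  simp only [posLaw, Measure.smul_apply, Measure.coe_finsetSum, Finset.sum_apply, hmap, hpre,
    Finset.sum_const_zero, smul_zero]

/-- The reference measure `vol ⊗ γ` is a probability measure (instance on the `def`). -/
instance isProbabilityMeasure_refMeasure : IsProbabilityMeasure refMeasure := by
  haveI hT3 : IsProbabilityMeasure (volume : Measure T3) := ⟨by rw [volume_pi, Measure.pi_univ]; simp⟩
  change IsProbabilityMeasure ((volume : Measure T3).prod (stdGaussian V3)); infer_instance

/-- The reduced one-body law of the witness as a density against `vol ⊗ γ`: `f_t = (n ⊗ r) · (vol ⊗ γ)` with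
`n = dπ̄_N/dvol`, `r = velMixDensity`. -/
theorem oneBodyLaw_mixtureLaw_eq_withDensity {σ : ℝ} (hσ2 : σ ≤ 1 / 2) (N : ℕ) (Φ : Flow σ N) (t : ℝ) :
    oneBodyLaw 1 0 Φ (mixtureLaw σ N Φ) t =
      refMeasure.withDensity
        (fun y => (posLaw σ N).rnDeriv volume y.1 * ENNReal.ofReal (velMixDensity y.2)) := by
  haveI := isProbabilityMeasure_posLaw hσ2 N
  have hπ : (volume : Measure T3).withDensity ((posLaw σ N).rnDeriv volume) = posLaw σ N :=
    Measure.withDensity_rnDeriv_eq _ _ (posLaw_absolutelyContinuous σ N)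
  rw [oneBodyLaw_mixtureLaw hσ2 N Φ t, velMix_eq_withDensity]
  conv_lhs => rw [← hπ]
  exact prod_withDensity (Measure.measurable_rnDeriv _ _) continuous_velMixDensity.measurable.ennreal_ofReal

/-- `cutDensity` is the cut of `oneBodyDensity` (definitional). -/
theorem cutDensity_eq_indicator_oneBodyDensity {ε : ℝ} {n : ℕ} (K θ : ℝ) (u₀ : V3) (Φ : TFlow ε n)
    (ν : Measure (TPhase n)) (t : ℝ) :
    cutDensity K θ u₀ Φ ν t =
      ({x | posDensity θ u₀ Φ ν t x ≤ K} ×ˢ (Set.univ : Set V3)).indicator (oneBodyDensity θ u₀ Φ ν t) :=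
  rfl

/-- **The production of the cut density of the witness**:
`𝒟(cutDensity K) = (∫ (1_{n ≤ K} n)² dvol) · D(r)`, for every time `t` and every flow (`σ ≤ 1/2`). -/
theorem production_cutDensity_mixtureLaw {σ : ℝ} (hσ2 : σ ≤ 1 / 2) (N : ℕ) (Φ : Flow σ N) (t K : ℝ) :
    production (cutDensity K 1 0 Φ (mixtureLaw σ N Φ) t) =
      (∫⁻ x, ENNReal.ofReal
          (({x | ((posLaw σ N).rnDeriv volume x).toReal ≤ K}.indicator
            (fun x => ((posLaw σ N).rnDeriv volume x).toReal) x) ^ 2)) * velMixProduction := by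
  set ν := mixtureLaw σ N Φ with hν
  set n : T3 → ℝ := fun x => ((posLaw σ N).rnDeriv volume x).toReal with hn
  have hf : oneBodyLaw 1 0 Φ ν t = (posLaw σ N).prod velMix := oneBodyLaw_mixtureLaw hσ2 N Φ t
  have hfst : (oneBodyLaw 1 0 Φ ν t).fst = posLaw σ N := by rw [hf, Measure.fst_prod]
  have hpd : posDensity 1 0 Φ ν t = n := by
    funext x; simp only [posDensity, hfst, hn]
  have hρ : (fun y => ((oneBodyLaw 1 0 Φ ν t).rnDeriv refMeasure y).toReal) =ᵐ[refMeasure]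
      fun y => n y.1 * velMixDensity y.2 := by
    rw [oneBodyLaw_mixtureLaw_eq_withDensity hσ2 N Φ t]
    have hF : Measurable fun y : T3 × V3 =>
        (posLaw σ N).rnDeriv volume y.1 * ENNReal.ofReal (velMixDensity y.2) :=
      ((Measure.measurable_rnDeriv _ _).comp measurable_fst).mul
        (continuous_velMixDensity.measurable.ennreal_ofReal.comp measurable_snd)
    filter_upwards [Measure.rnDeriv_withDensity refMeasure hF] with y hy
    rw [hy, ENNReal.toReal_mul, ENNReal.toReal_ofReal (velMixDensity_pos _).le]
  have hcut : cutDensity K 1 0 Φ ν t =ᵐ[refMeasure]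
      fun y => {x | n x ≤ K}.indicator n y.1 * velMixDensity y.2 := by
    rw [cutDensity_eq_indicator_oneBodyDensity, hpd]
    filter_upwards [hρ] with y hy
    have hy' : oneBodyDensity 1 0 Φ ν t y = n y.1 * velMixDensity y.2 := hy
    by_cases hyS : n y.1 ≤ K
    · rw [Set.indicator_of_mem (show y ∈ {x | n x ≤ K} ×ˢ (Set.univ : Set V3) from ⟨hyS, Set.mem_univ _⟩),
        Set.indicator_of_mem (show y.1 ∈ {x | n x ≤ K} from hyS), hy']
    · rw [Set.indicator_of_notMem (show y ∉ {x | n x ≤ K} ×ˢ (Set.univ : Set V3) from fun h => hyS h.1),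
        Set.indicator_of_notMem (show y.1 ∉ {x | n x ≤ K} from hyS), zero_mul]
  rw [Localise.production_congr_ae hcut]
  have hnm : Measurable n := (Measure.measurable_rnDeriv _ _).ennreal_toReal
  exact production_tensor (fun x => Set.indicator_nonneg (fun _ _ => ENNReal.toReal_nonneg) x)
    (hnm.indicator (measurableSet_le hnm measurable_const)) velMixDensity

/-- **Constant positive production of the witness below the cut**: for `0 < σ ≤ 1/2`, every `N`, every flow,
every time `t` and every cut level `K ≥ exp(4(S₀ + 2))`,
`𝒟(cutDensity K of ν at t) ≥ ¼ D(r)` — Cauchy–Schwarz `∫(1_{n≤K} n)² ≥ (π̄_N{n ≤ K})²` on the probability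
space `(𝕋³, vol)` and the position-tail budget `π̄_N{n > K} ≤ 2(S₀ + 2)/log K ≤ ½` (`stub_positionTailBudget`
with `KL(ν‖G_N) ≤ (N+1) S₀`). -/
theorem quarter_le_production_cutDensity {σ : ℝ} (hσ : 0 < σ) (hσ2 : σ ≤ 1 / 2) (N : ℕ) (Φ : Flow σ N)
    (t : ℝ) {K : ℝ} (hK : Real.exp (4 * (klConst + 2)) ≤ K) :
    ENNReal.ofReal 4⁻¹ * velMixProduction ≤ production (cutDensity K 1 0 Φ (mixtureLaw σ N Φ) t) := by
  haveI hT3 : IsProbabilityMeasure (volume : Measure T3) := ⟨by rw [volume_pi, Measure.pi_univ]; simp⟩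
  haveI := isProbabilityMeasure_posLaw hσ2 N
  haveI := isProbabilityMeasure_mixtureLaw hσ2 N Φ
  haveI := isProbabilityMeasure_gibbs one_pos hσ2 N Φ
  rw [production_cutDensity_mixtureLaw hσ2 N Φ t K]
  set π := posLaw σ N with hπ
  set n : T3 → ℝ := fun x => (π.rnDeriv volume x).toReal with hn
  set S : Set T3 := {x | n x ≤ K} with hS
  set c : T3 → ℝ := S.indicator n with hc
  have hK0 : 0 < K := (Real.exp_pos _).trans_le hK
  have hkl := klConst_nonneg
  have hnm : Measurable n := (Measure.measurable_rnDeriv _ _).ennreal_toReal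
  have hSm : MeasurableSet S := measurableSet_le hnm measurable_const
  have hcm : Measurable c := hnm.indicator hSm
  have hc0 : ∀ x, 0 ≤ c x := fun x => Set.indicator_nonneg (fun _ _ => ENNReal.toReal_nonneg) x
  have hcK : ∀ x, c x ≤ K := fun x =>
    Set.indicator_apply_le' (fun hx => hx) (fun _ => hK0.le)
  have hci : Integrable c volume :=
    (integrable_const K).mono' hcm.aestronglyMeasurable
      (ae_of_all _ fun x => by rw [Real.norm_eq_abs, abs_of_nonneg (hc0 x)]; exact hcK x)
  have hc2i : Integrable (fun x => c x ^ 2) volume :=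
    (integrable_const (K ^ 2)).mono' (hcm.pow_const 2).aestronglyMeasurable
      (ae_of_all _ fun x => by
        rw [Real.norm_eq_abs, abs_of_nonneg (sq_nonneg _)]
        exact pow_le_pow_left₀ (hc0 x) (hcK x) 2)
  -- the mass below the cut
  have hac : π ≪ volume := posLaw_absolutelyContinuous σ N
  have hm : ∫ x, c x = π.real S := by
    rw [hc, integral_indicator hSm]
    exact Measure.setIntegral_toReal_rnDeriv hac S
  -- Cauchy–Schwarz on the probability space `(𝕋³, vol)`
  have hCS : (π.real S) ^ 2 ≤ ∫ x, c x ^ 2 := by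
    have h0 : 0 ≤ ∫ x, (c x - π.real S) ^ 2 := integral_nonneg fun x => sq_nonneg _
    have hexp : ∫ x, (c x - π.real S) ^ 2 =
        (∫ x, c x ^ 2) - 2 * π.real S * (∫ x, c x) + (π.real S) ^ 2 := by
      have : (fun x => (c x - π.real S) ^ 2) = fun x => (c x ^ 2 - 2 * π.real S * c x) + (π.real S) ^ 2 := by
        funext x; ring
      have hi2 : Integrable (fun x => 2 * π.real S * c x) volume := hci.const_mul _
      have hi1 : Integrable (fun x => c x ^ 2 - 2 * π.real S * c x) volume := hc2i.sub hi2
      rw [this, integral_add hi1 (integrable_const _), integral_sub hc2i hi2, integral_const_mul, integral_const,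
        probReal_univ, one_smul]
    rw [hexp, hm] at h0
    nlinarith
  -- the tail budget: `π(Sᶜ) ≤ 1/2`
  have htail : π.real Sᶜ ≤ 2⁻¹ := by
    have hν_ac := mixtureLaw_absolutelyContinuous σ N Φ
    obtain ⟨hkl_ne, hkl_le⟩ := klDiv_mixtureLaw_le hσ2 N Φ
    have hK2 : Real.exp 2 ≤ K := (Real.exp_le_exp.2 (by nlinarith)).trans hK
    have hPTB := stub_positionTailBudget σ 1 1 0 N Φ (mixtureLaw σ N Φ) inferInstance one_pos one_pos hσ hσ2
      hν_ac hkl_ne t K hK2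
    have hf : oneBodyLaw 1 0 Φ (mixtureLaw σ N Φ) t = π.prod velMix := oneBodyLaw_mixtureLaw hσ2 N Φ t
    have hfst : (oneBodyLaw 1 0 Φ (mixtureLaw σ N Φ) t).fst = π := by rw [hf, Measure.fst_prod]
    have hpd : posDensity 1 0 Φ (mixtureLaw σ N Φ) t = n := by
      funext x; simp only [posDensity, hfst, hn]
    rw [hfst, hpd] at hPTB
    have hset : {x | K < n x} = Sᶜ := by
      ext x; simp [hS, not_le]
    rw [hset] at hPTB
    have hlogK : 4 * (klConst + 2) ≤ Real.log K := (Real.le_log_iff_exp_le hK0).2 hK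
    have hlog0 : 0 < Real.log K := lt_of_lt_of_le (by nlinarith) hlogK
    have hN : (0 : ℝ) < ((N + 1 : ℕ) : ℝ) := by positivity
    -- `(N+1) π(Sᶜ) ≤ 2((N+1)S₀ + 2(N+1))/log K`
    have h1 : ((N + 1 : ℕ) : ℝ) * π.real Sᶜ ≤
        2 * (((N + 1 : ℕ) : ℝ) * klConst + 2 * ((N + 1 : ℕ) : ℝ)) / Real.log K := by
      refine hPTB.trans ?_
      gcongr
    have h2 : π.real Sᶜ ≤ 2 * (klConst + 2) / Real.log K := by
      rw [le_div_iff₀ hlog0] at h1 ⊢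
      nlinarith
    calc π.real Sᶜ ≤ 2 * (klConst + 2) / Real.log K := h2
      _ ≤ 2 * (klConst + 2) / (4 * (klConst + 2)) := by gcongr
      _ = 2⁻¹ := by field_simp; ring
  have hmS : 2⁻¹ ≤ π.real S := by
    have := probReal_compl_eq_one_sub hSm (μ := π)
    linarith
  -- assemble
  have hmain : ENNReal.ofReal 4⁻¹ ≤ ∫⁻ x, ENNReal.ofReal (c x ^ 2) :=
    calc ENNReal.ofReal 4⁻¹ ≤ ENNReal.ofReal ((π.real S) ^ 2) := ENNReal.ofReal_le_ofReal (by nlinarith)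
      _ ≤ ENNReal.ofReal (∫ x, c x ^ 2) := ENNReal.ofReal_le_ofReal hCS
      _ = ∫⁻ x, ENNReal.ofReal (c x ^ 2) :=
          ofReal_integral_eq_lintegral_ofReal hc2i (ae_of_all _ fun x => sq_nonneg _)
  exact mul_le_mul' hmain le_rfl

/-- **Constant positive production of the witness, uncut**: `𝒟(ρ_t^ν) ≥ ¼ D(r)` as well (cutting only lowers
the production). -/
theorem quarter_le_production_oneBodyDensity {σ : ℝ} (hσ : 0 < σ) (hσ2 : σ ≤ 1 / 2) (N : ℕ) (Φ : Flow σ N)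
    (t : ℝ) : ENNReal.ofReal 4⁻¹ * velMixProduction ≤ production (oneBodyDensity 1 0 Φ (mixtureLaw σ N Φ) t) :=
  (quarter_le_production_cutDensity hσ hσ2 N Φ t le_rfl).trans (by
    rw [cutDensity_eq_indicator_oneBodyDensity]
    exact production_indicator_prod_le _ _)

end MixtureWitness

end Summit.AtomisticToContinuum.HydrodynamicLimit.Theorems.HTheorem

end
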